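import Literature.NumberTheory.LFunctions.KloostermanFractionsDFIfromBC
import HarnessLib

/-!
# Bilinear forms with Kloosterman fractions: reciprocity and the range `M < N` (Bettin–Chandee §7)

Topic `NumberTheory/LFunctions`.  S. Bettin, V. Chandee, *Trilinear forms with Kloosterman
fractions*, Adv. Math. 328 (2018), end of §7: having proved (7.2) (their Theorem 1 in the range
`M ≥ N`, together with its twisted form (gfd) of Remark 2), "we now observe that the elementary
reciprocity law allows us to write `𝓑(M,N,A) = ∑∑∑ α_m β_n ν_a e(-ϑa n̄/m + ϑa/(mn))`.  Thus, if
`M < N` we can apply (gfd) with the role of `M` and `N` switched and with `f_{a,ϑ}(x,y) = ϑa/(xy)`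
… and so the proof of Theorem 1 is complete."  This file PROVES that step for a single numerator
(`A = 1`, `ϑ = k`), in the conventions of the named fact
`DukeFriedlanderIwaniec1997_bilinearKloostermanFractions` (`DeterminantEquationDFI.lean`):

* `DFI_e_reciprocity` — `e(k m̄⁽ⁿ⁾/n) = e(-k n̄⁽ᵐ⁾/m + k/(mn))` for coprime `m, n ≥ 1`
  (`m m̄ + n n̄ ≡ 1 (mod mn)`);
* `DFI_bilinear_eq_swap` — hence the untwisted form on `(M,2M] × (N,2N]` equals the twisted form
  (numerator `-k`, twist `X = k`) with the two variables exchanged; `DFI_bilinear_twisted_zero`;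
* `DFI_terms72_le` — `(UV)^ε(U^{1/2}V^{3/8} + U^{3/5}V^{7/20}) ≤ (UV)^{7/20+ε}(U+V)^{1/4} + (UV)^{3/8+ε}(U+V)^{1/8}`;
* **`DFI_BC_allRanges_of_twisted_MgeN`** — (7.2)+Remark 2 for `1/2 ≤ N ≤ M` (hypothesis, written
  out) ⟹ Theorem 1 of Bettin–Chandee (case `A = 1`) for all `M, N ≥ 1/2`;
* **`DukeFriedlanderIwaniec1997_bilinearKloostermanFractions_of_BC_twisted_MgeN`** — ⟹ the named
  fact, through `DukeFriedlanderIwaniec1997_bilinearKloostermanFractions_of_BettinChandee`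
  (`KloostermanFractionsDFIfromBC.lean`).

So, for the named fact, what remains of Bettin–Chandee's paper is exactly §§3–6 and (7.2) in the
range `M ≥ N` with the twist of Remark 2 (case `A = 1`).

## References

* S. Bettin, V. Chandee, Adv. Math. 328 (2018) 1234–1262 (arXiv:1502.00769), §7 ((7.2), Remark 2,
  the reciprocity step). [BettinChandee2018]
* W. Duke, J. Friedlander, H. Iwaniec, Invent. Math. 128 (1997) 23–43, Theorem 2.
  [DukeFriedlanderIwaniec1997]
-/

noncomputable section

open Finset Real

namespace Literature.NumberTheory.LFunctions

/-- **Reciprocity for Kloosterman fractions**: for coprime `m, n ≥ 1`,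
`m̄⁽ⁿ⁾/n ≡ -n̄⁽ᵐ⁾/m + 1/(mn) (mod 1)`, i.e. `e(k m̄/n) = e(-k n̄/m + k/(mn))`
(from `m m̄ + n n̄ ≡ 1 (mod mn)`).  Written with the phases exactly as in the named fact
`DukeFriedlanderIwaniec1997_bilinearKloostermanFractions` (numerator `-k`, twist `X = k`).
[cite: BettinChandee2018, §7 (the elementary reciprocity law)] -/
theorem DFI_e_reciprocity {m n : ℕ} (hm : 0 < m) (hn : 0 < n) (hcop : m.Coprime n) (k : ℤ) :
    Complex.exp (2 * Real.pi * Complex.I *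
        ((k : ℂ) * ((((m : ZMod n)⁻¹).val : ℕ) : ℂ) / (n : ℂ))) =
      Complex.exp (2 * Real.pi * Complex.I *
        (((-k : ℤ) : ℂ) * ((((n : ZMod m)⁻¹).val : ℕ) : ℂ) / (m : ℂ) +
          (((k : ℝ)) : ℂ) / ((n : ℂ) * m))) := by
  haveI : NeZero m := ⟨hm.ne'⟩
  haveI : NeZero n := ⟨hn.ne'⟩
  set u : ℕ := ((m : ZMod n)⁻¹).val with hu
  set v : ℕ := ((n : ZMod m)⁻¹).val with hv
  -- `m u + n v ≡ 1 (mod mn)`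
  have h1 : (m * u + n * v) ≡ 1 [MOD n] := by
    have : ((m * u + n * v : ℕ) : ZMod n) = ((1 : ℕ) : ZMod n) := by
      push_cast
      rw [ZMod.natCast_self, zero_mul, add_zero, hu, ZMod.natCast_zmod_val,
        ZMod.coe_mul_inv_eq_one m hcop]
    exact (ZMod.natCast_eq_natCast_iff _ _ _).mp this
  have h2 : (m * u + n * v) ≡ 1 [MOD m] := by
    have : ((m * u + n * v : ℕ) : ZMod m) = ((1 : ℕ) : ZMod m) := by
      push_cast
      rw [ZMod.natCast_self, zero_mul, zero_add, hv, ZMod.natCast_zmod_val,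
        ZMod.coe_mul_inv_eq_one n hcop.symm]
    exact (ZMod.natCast_eq_natCast_iff _ _ _).mp this
  have h12 : (m * u + n * v) ≡ 1 [MOD m * n] :=
    (Nat.modEq_and_modEq_iff_modEq_mul hcop).mp ⟨h2, h1⟩
  obtain ⟨t, ht⟩ : ∃ t : ℤ, ((m : ℤ) * u + n * v) = 1 + t * ((m : ℤ) * n) := by
    obtain ⟨c, hc⟩ := h12.dvd
    refine ⟨-c, ?_⟩
    push_cast at hc
    linear_combination (-1 : ℤ) * hc
  apply Complex.exp_eq_exp_iff_exists_int.mpr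
  refine ⟨k * t, ?_⟩
  have hmC : (m : ℂ) ≠ 0 := by exact_mod_cast hm.ne'
  have hnC : (n : ℂ) ≠ 0 := by exact_mod_cast hn.ne'
  have htC : ((m : ℂ) * u + n * v) = 1 + (t : ℂ) * ((m : ℂ) * n) := by exact_mod_cast ht
  push_cast
  field_simp
  linear_combination (k : ℂ) * htC

/-- **Swapping the variables**: with the phases as in the named fact,
`∑∑_{(m,n)=1} α_m β_n e(k m̄/n) = ∑∑_{(n,m)=1} β_n α_m e(-k n̄/m + k/(nm))`, i.e. the untwisted
bilinear form on `(M,2M] × (N,2N]` is the twisted form (twist `X = k`, numerator `-k`) with the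
roles of the two variables exchanged (Bettin–Chandee, end of §7). [cite: BettinChandee2018, §7] -/
theorem DFI_bilinear_eq_swap (M N : ℝ) (k : ℤ) (α β : ℕ → ℂ) :
    (∑ m ∈ Icc 1 ⌊2 * M⌋₊, ∑ n ∈ Icc 1 ⌊2 * N⌋₊,
        if m.Coprime n then
          α m * β n * Complex.exp (2 * Real.pi * Complex.I *
            ((k : ℂ) * ((((m : ZMod n)⁻¹).val : ℕ) : ℂ) / (n : ℂ)))
        else 0) =
      ∑ n ∈ Icc 1 ⌊2 * N⌋₊, ∑ m ∈ Icc 1 ⌊2 * M⌋₊,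
        if n.Coprime m then
          β n * α m * Complex.exp (2 * Real.pi * Complex.I *
            (((-k : ℤ) : ℂ) * ((((n : ZMod m)⁻¹).val : ℕ) : ℂ) / (m : ℂ) +
              (((k : ℝ)) : ℂ) / ((n : ℂ) * m)))
        else 0 := by
  rw [Finset.sum_comm]
  refine Finset.sum_congr rfl fun n hn => Finset.sum_congr rfl fun m hm => ?_
  have hm0 : 0 < m := (Finset.mem_Icc.mp hm).1
  have hn0 : 0 < n := (Finset.mem_Icc.mp hn).1
  by_cases h : m.Coprime n
  · rw [if_pos h, if_pos (Nat.coprime_comm.mp h), DFI_e_reciprocity hm0 hn0 h k]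
    ring
  · rw [if_neg h, if_neg (fun h' => h (Nat.coprime_comm.mp h'))]

/-- The twisted form at `X = 0` is the untwisted form. [folklore] -/
theorem DFI_bilinear_twisted_zero (M N : ℝ) (k : ℤ) (α β : ℕ → ℂ) :
    (∑ m ∈ Icc 1 ⌊2 * M⌋₊, ∑ n ∈ Icc 1 ⌊2 * N⌋₊,
        if m.Coprime n then
          α m * β n * Complex.exp (2 * Real.pi * Complex.I *
            ((k : ℂ) * ((((m : ZMod n)⁻¹).val : ℕ) : ℂ) / (n : ℂ) + (((0 : ℝ)) : ℂ) / ((m : ℂ) * n)))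
        else 0) =
      ∑ m ∈ Icc 1 ⌊2 * M⌋₊, ∑ n ∈ Icc 1 ⌊2 * N⌋₊,
        if m.Coprime n then
          α m * β n * Complex.exp (2 * Real.pi * Complex.I *
            ((k : ℂ) * ((((m : ZMod n)⁻¹).val : ℕ) : ℂ) / (n : ℂ)))
        else 0 := by
  simp only [Complex.ofReal_zero, zero_div, add_zero]

/-- **The exponents of Bettin–Chandee (7.2) versus Theorem 1**: for `U, V > 0`, `ε ≥ 0`,
`(UV)^ε (U^{1/2} V^{3/8} + U^{3/5} V^{7/20}) ≤ (UV)^{7/20+ε}(U+V)^{1/4} + (UV)^{3/8+ε}(U+V)^{1/8}`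
(`U^{1/2}V^{3/8} = (UV)^{3/8} U^{1/8}`, `U^{3/5}V^{7/20} = (UV)^{7/20} U^{1/4}`, `U ≤ U + V`).
[cite: BettinChandee2018, §7] -/
theorem DFI_terms72_le {U V : ℝ} (ε : ℝ) (hU : 0 < U) (hV : 0 < V) :
    (U * V) ^ ε * (U ^ (1 / 2 : ℝ) * V ^ (3 / 8 : ℝ) + U ^ (3 / 5 : ℝ) * V ^ (7 / 20 : ℝ)) ≤
      (U * V) ^ (7 / 20 + ε) * (U + V) ^ (1 / 4 : ℝ) + (U * V) ^ (3 / 8 + ε) * (U + V) ^ (1 / 8 : ℝ) := by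
  have hUV : 0 < U * V := mul_pos hU hV
  have hP : 0 < U + V := by linarith
  obtain ⟨a, ha⟩ : ∃ a : ℝ, a = Real.log U := ⟨_, rfl⟩
  obtain ⟨b, hb⟩ : ∃ b : ℝ, b = Real.log V := ⟨_, rfl⟩
  obtain ⟨p, hp⟩ : ∃ p : ℝ, p = Real.log (U + V) := ⟨_, rfl⟩
  have hap : a ≤ p := by rw [ha, hp]; exact Real.log_le_log hU (by linarith)
  have hlogUV : Real.log (U * V) = a + b := by rw [Real.log_mul hU.ne' hV.ne', ha, hb]
  have eU : ∀ c : ℝ, U ^ c = Real.exp (c * a) := fun c => by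
    rw [Real.rpow_def_of_pos hU, mul_comm, ha]
  have eV : ∀ c : ℝ, V ^ c = Real.exp (c * b) := fun c => by
    rw [Real.rpow_def_of_pos hV, mul_comm, hb]
  have eUV : ∀ c : ℝ, (U * V) ^ c = Real.exp (c * (a + b)) := fun c => by
    rw [Real.rpow_def_of_pos hUV, mul_comm, hlogUV]
  have eP : ∀ c : ℝ, (U + V) ^ c = Real.exp (c * p) := fun c => by
    rw [Real.rpow_def_of_pos hP, mul_comm, hp]
  have hA : (U * V) ^ ε * (U ^ (1 / 2 : ℝ) * V ^ (3 / 8 : ℝ)) ≤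
      (U * V) ^ (3 / 8 + ε) * (U + V) ^ (1 / 8 : ℝ) := by
    rw [eUV, eU, eV, eUV, eP, ← Real.exp_add, ← Real.exp_add, ← Real.exp_add]
    exact Real.exp_le_exp.mpr (by linarith)
  have hB : (U * V) ^ ε * (U ^ (3 / 5 : ℝ) * V ^ (7 / 20 : ℝ)) ≤
      (U * V) ^ (7 / 20 + ε) * (U + V) ^ (1 / 4 : ℝ) := by
    rw [eUV, eU, eV, eUV, eP, ← Real.exp_add, ← Real.exp_add, ← Real.exp_add]
    exact Real.exp_le_exp.mpr (by linarith)
  rw [mul_add, add_comm ((U * V) ^ (7 / 20 + ε) * (U + V) ^ (1 / 4 : ℝ))]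
  exact add_le_add hA hB

/-- **Bettin–Chandee, §7: from the twisted bound in the range `M ≥ N` to all ranges.**  Suppose
(Bettin–Chandee (7.2) with Remark 2, case `A = 1`, `ϑ = k`, in the tree's conventions) that for
every `ε > 0` there is `K` with, for all `1/2 ≤ N ≤ M`, `k ≠ 0`, real `X` and all `α_m`
(`M < m ≤ 2M`), `β_n` (`N < n ≤ 2N`),
`|∑∑_{(m,n)=1} α_m β_n e(k m̄/n + X/mn)| ≤ K ‖α‖‖β‖ (MN)^ε (1 + (|k|+|X|)/MN)^{1/2} (M^{1/2}N^{3/8} + M^{3/5}N^{7/20})`.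
Then Bettin–Chandee's Theorem 1 (case `A = 1`) holds in all ranges `M, N ≥ 1/2`:
`|∑∑_{(m,n)=1} α_m β_n e(k m̄/n)| ≤ 2K ‖α‖‖β‖ (1 + |k|/MN)^{1/2}((MN)^{7/20+ε}(M+N)^{1/4} + (MN)^{3/8+ε}(M+N)^{1/8})`
("if `M < N` we can apply (gfd) with the role of `M` and `N` switched and with
`f(x,y) = ϑa/(xy)`", by the reciprocity `DFI_bilinear_eq_swap`). [cite: BettinChandee2018, §7] -/
theorem DFI_BC_allRanges_of_twisted_MgeN
    (h : ∀ ε : ℝ, 0 < ε → ∃ K : ℝ, 0 < K ∧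
      ∀ (M N : ℝ), 1 / 2 ≤ N → N ≤ M → ∀ (k : ℤ), k ≠ 0 → ∀ (X : ℝ) (α β : ℕ → ℂ),
        (∀ m : ℕ, α m ≠ 0 → M < m ∧ (m : ℝ) ≤ 2 * M) →
        (∀ n : ℕ, β n ≠ 0 → N < n ∧ (n : ℝ) ≤ 2 * N) →
        ‖∑ m ∈ Icc 1 ⌊2 * M⌋₊, ∑ n ∈ Icc 1 ⌊2 * N⌋₊,
            if m.Coprime n then
              α m * β n * Complex.exp (2 * Real.pi * Complex.I *
                ((k : ℂ) * ((((m : ZMod n)⁻¹).val : ℕ) : ℂ) / (n : ℂ) + (X : ℂ) / ((m : ℂ) * n)))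
            else 0‖ ≤
          K * Real.sqrt (∑ m ∈ Icc 1 ⌊2 * M⌋₊, ‖α m‖ ^ 2) *
            Real.sqrt (∑ n ∈ Icc 1 ⌊2 * N⌋₊, ‖β n‖ ^ 2) * (M * N) ^ ε *
            (1 + (|(k : ℝ)| + |X|) / (M * N)) ^ (1 / 2 : ℝ) *
            (M ^ (1 / 2 : ℝ) * N ^ (3 / 8 : ℝ) + M ^ (3 / 5 : ℝ) * N ^ (7 / 20 : ℝ))) :
    ∀ ε : ℝ, 0 < ε → ∃ K : ℝ, 0 < K ∧
      ∀ (M N : ℝ), 1 / 2 ≤ M → 1 / 2 ≤ N → ∀ (k : ℤ), k ≠ 0 → ∀ (α β : ℕ → ℂ),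
        (∀ m : ℕ, α m ≠ 0 → M < m ∧ (m : ℝ) ≤ 2 * M) →
        (∀ n : ℕ, β n ≠ 0 → N < n ∧ (n : ℝ) ≤ 2 * N) →
        ‖∑ m ∈ Icc 1 ⌊2 * M⌋₊, ∑ n ∈ Icc 1 ⌊2 * N⌋₊,
            if m.Coprime n then
              α m * β n * Complex.exp (2 * Real.pi * Complex.I *
                ((k : ℂ) * ((((m : ZMod n)⁻¹).val : ℕ) : ℂ) / (n : ℂ)))
            else 0‖ ≤
          K * Real.sqrt (∑ m ∈ Icc 1 ⌊2 * M⌋₊, ‖α m‖ ^ 2) *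
            Real.sqrt (∑ n ∈ Icc 1 ⌊2 * N⌋₊, ‖β n‖ ^ 2) *
            (1 + |(k : ℝ)| / (M * N)) ^ (1 / 2 : ℝ) *
            ((M * N) ^ (7 / 20 + ε) * (M + N) ^ (1 / 4 : ℝ) +
              (M * N) ^ (3 / 8 + ε) * (M + N) ^ (1 / 8 : ℝ)) := by
  intro ε hε
  obtain ⟨K, hK, hB⟩ := h ε hε
  refine ⟨2 * K, by positivity, ?_⟩
  intro M N hM hN k hk α β hα hβ
  have hM0 : 0 < M := by linarith
  have hN0 : 0 < N := by linarith
  set nα := Real.sqrt (∑ m ∈ Icc 1 ⌊2 * M⌋₊, ‖α m‖ ^ 2) with hnα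
  set nβ := Real.sqrt (∑ n ∈ Icc 1 ⌊2 * N⌋₊, ‖β n‖ ^ 2) with hnβ
  have hnα0 : 0 ≤ nα := Real.sqrt_nonneg _
  have hnβ0 : 0 ≤ nβ := Real.sqrt_nonneg _
  set RHS : ℝ := (M * N) ^ (7 / 20 + ε) * (M + N) ^ (1 / 4 : ℝ) +
    (M * N) ^ (3 / 8 + ε) * (M + N) ^ (1 / 8 : ℝ) with hRHS
  have hRHS0 : 0 ≤ RHS := by positivity
  set W : ℝ := (1 + |(k : ℝ)| / (M * N)) ^ (1 / 2 : ℝ) with hW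
  have hW0 : 0 ≤ W := by positivity
  rcases le_or_gt N M with hNM | hMN
  · -- `N ≤ M`: the hypothesis at `X = 0`
    have h1 := hB M N hN hNM k hk 0 α β hα hβ
    rw [DFI_bilinear_twisted_zero, abs_zero, add_zero] at h1
    have h72 := DFI_terms72_le ε hM0 hN0
    calc _ ≤ _ := h1
      _ = K * nα * nβ * W *
          ((M * N) ^ ε * (M ^ (1 / 2 : ℝ) * N ^ (3 / 8 : ℝ) + M ^ (3 / 5 : ℝ) * N ^ (7 / 20 : ℝ))) := by
          rw [hW]; ring
      _ ≤ K * nα * nβ * W * RHS := by gcongr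
      _ ≤ 2 * K * nα * nβ * W * RHS := by
          have : 0 ≤ K * nα * nβ * W * RHS := by positivity
          linarith
  · -- `M < N`: swap the variables (reciprocity), then the hypothesis at `(N, M)`, `-k`, `X = k`
    rw [DFI_bilinear_eq_swap]
    have h2 := hB N M hM hMN.le (-k) (neg_ne_zero.mpr hk) (k : ℝ) β α hβ hα
    have habs : |((-k : ℤ) : ℝ)| = |(k : ℝ)| := by rw [Int.cast_neg, abs_neg]
    rw [habs, mul_comm N M] at h2
    have h72 := DFI_terms72_le ε hN0 hM0
    rw [mul_comm N M, add_comm N M] at h72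
    -- `(1 + 2|k|/MN)^{1/2} ≤ (3/2) (1 + |k|/MN)^{1/2}`
    have hsqrt2 : (2 : ℝ) ^ (1 / 2 : ℝ) ≤ 3 / 2 := by
      rw [← Real.sqrt_eq_rpow, Real.sqrt_le_left (by norm_num)]
      norm_num
    have hfac : (1 + (|(k : ℝ)| + |(k : ℝ)|) / (M * N)) ^ (1 / 2 : ℝ) ≤ 3 / 2 * W := by
      have h3 : 1 + (|(k : ℝ)| + |(k : ℝ)|) / (M * N) ≤ 2 * (1 + |(k : ℝ)| / (M * N)) := by
        have : 0 ≤ |(k : ℝ)| / (M * N) := by positivity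
        have e : (|(k : ℝ)| + |(k : ℝ)|) / (M * N) = 2 * (|(k : ℝ)| / (M * N)) := by ring
        rw [e]; linarith
      calc (1 + (|(k : ℝ)| + |(k : ℝ)|) / (M * N)) ^ (1 / 2 : ℝ)
          ≤ (2 * (1 + |(k : ℝ)| / (M * N))) ^ (1 / 2 : ℝ) :=
            Real.rpow_le_rpow (by positivity) h3 (by norm_num)
        _ = (2 : ℝ) ^ (1 / 2 : ℝ) * W := by
            rw [hW, Real.mul_rpow (by norm_num) (by positivity)]
        _ ≤ 3 / 2 * W := by gcongr
    calc _ ≤ _ := h2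
      _ = K * nα * nβ * (1 + (|(k : ℝ)| + |(k : ℝ)|) / (M * N)) ^ (1 / 2 : ℝ) *
          ((M * N) ^ ε * (N ^ (1 / 2 : ℝ) * M ^ (3 / 8 : ℝ) + N ^ (3 / 5 : ℝ) * M ^ (7 / 20 : ℝ))) := by
          ring
      _ ≤ K * nα * nβ * (3 / 2 * W) * RHS := by gcongr
      _ ≤ 2 * K * nα * nβ * W * RHS := by
          have : 0 ≤ K * nα * nβ * W * RHS := by positivity
          linarith

/-- **The named fact from Bettin–Chandee (7.2) + Remark 2 (case `A = 1`).**  The twisted bound in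
the range `M ≥ N` (hypothesis of `DFI_BC_allRanges_of_twisted_MgeN`) implies
`DukeFriedlanderIwaniec1997_bilinearKloostermanFractions` (via `DFI_BC_allRanges_of_twisted_MgeN`
and `DukeFriedlanderIwaniec1997_bilinearKloostermanFractions_of_BettinChandee`).  This isolates
what remains to be proved of Bettin–Chandee's paper for the named fact: §§3–6 and (7.2) for
`M ≥ N`, with the twist of Remark 2. [cite: BettinChandee2018, §7]
[cite: DukeFriedlanderIwaniec1997, Theorem 2] -/
theorem DukeFriedlanderIwaniec1997_bilinearKloostermanFractions_of_BC_twisted_MgeN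
    (h : ∀ ε : ℝ, 0 < ε → ∃ K : ℝ, 0 < K ∧
      ∀ (M N : ℝ), 1 / 2 ≤ N → N ≤ M → ∀ (k : ℤ), k ≠ 0 → ∀ (X : ℝ) (α β : ℕ → ℂ),
        (∀ m : ℕ, α m ≠ 0 → M < m ∧ (m : ℝ) ≤ 2 * M) →
        (∀ n : ℕ, β n ≠ 0 → N < n ∧ (n : ℝ) ≤ 2 * N) →
        ‖∑ m ∈ Icc 1 ⌊2 * M⌋₊, ∑ n ∈ Icc 1 ⌊2 * N⌋₊,
            if m.Coprime n then
              α m * β n * Complex.exp (2 * Real.pi * Complex.I *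
                ((k : ℂ) * ((((m : ZMod n)⁻¹).val : ℕ) : ℂ) / (n : ℂ) + (X : ℂ) / ((m : ℂ) * n)))
            else 0‖ ≤
          K * Real.sqrt (∑ m ∈ Icc 1 ⌊2 * M⌋₊, ‖α m‖ ^ 2) *
            Real.sqrt (∑ n ∈ Icc 1 ⌊2 * N⌋₊, ‖β n‖ ^ 2) * (M * N) ^ ε *
            (1 + (|(k : ℝ)| + |X|) / (M * N)) ^ (1 / 2 : ℝ) *
            (M ^ (1 / 2 : ℝ) * N ^ (3 / 8 : ℝ) + M ^ (3 / 5 : ℝ) * N ^ (7 / 20 : ℝ))) :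
    DukeFriedlanderIwaniec1997_bilinearKloostermanFractions :=
  DukeFriedlanderIwaniec1997_bilinearKloostermanFractions_of_BettinChandee
    (DFI_BC_allRanges_of_twisted_MgeN h)

end Literature.NumberTheory.LFunctions

end
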